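import Literature.NumberTheory.Automorphic.UnitaryGroupKernelClassUnipotentTwo
import Literature.NumberTheory.Automorphic.UnitaryGroupKernelBorelClassHomogeneity
import HarnessLib

/-!
# The class Borel kernel of `U(J₂)` at the central class `z · 𝒰(F)` has the single torus fibre `z·1`:
# `K_{B,𝔬}(x, y) = ν(𝓕)⁻¹ ∫_{N(𝔸_F)} f(x⁻¹ z₁ m y) dν(m)`
(Rogawski, *Automorphic Representations of Unitary Groups in Three Variables* (1990), §2.2 p. 13:
`K_{P,𝔬}(x, y) = Σ_{γ ∈ M_P ∩ 𝔬̲′} ∫_{𝐍_P} f(x⁻¹ γ n y) dn`; Prop. 7.3.1 p. 98 (`G = U(2)`): the term `∫_𝐍 f(g⁻¹ γ n g) dn` of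
the central × unipotent class; §7.3 p. 95 for `U(3)`.)

Topic `NumberTheory/Automorphic`; namespace `Literature.NumberTheory.Automorphic.UnitaryGroup`. THEOREMS ONLY over accepted
tree modules (no definition, no named fact, no instance, no notation, no `sorry`). The `N = 2` twin of ★ B0 FILE 4
`UnitaryGroupKernelBorelClassUnipotent` (H-side copy of the LAW trunk of `Cruxes/H413/Lines/F0_T1InnerFormTraceIdentity.lean`
for `H = U(Φ₂) × U(Φ₁)`; cell hodgecm-mathlib, crux H413; CENSUS-LAWS-Hside §3 LAW 5 (σ-u)). Letters: `z ∈ E¹` as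
`ζ : ratOne F E c`, `z₁ = toAdelic (ratCenter ζ)` (★ `ratCenter`, every `N`), the class `{charpoly = (X − z)² ⊗ 𝔸_E}`.

* (letters) the every-`N` central-element letters ★ `coe_adelicVal_toAdelic_ratCenter_fin` ∕ `charpoly_toAdelic_ratCenter_fin` ∕
  `toAdelic_ratCenter_mul_comm_fin` are those of ★ `UnitaryGroupKernelClassUnipotentTwo` §1 (F0P3a-p08 (g7)), imported by name.
* §1 (`N = 2`) `coe_eq_toAdelic_ratCenter_of_charpoly_eq_sq_two` — the TORUS CELL of the class is the single point
  `z·1`: a rational torus element of `U(J₂)` with `charpoly = (X − z)² ⊗ 𝔸_E` IS `z·1`.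
* §2 (`N = 2`) **`kernelBorelClass_eq_smul_integral_central_two`** — `K_{B,𝔬}(x, y) = ν(𝓕)⁻¹ ∫_{N(𝔸_F)} f(x⁻¹ z₁ m y) dν(m)`
  for `f ∈ C_c(G(𝔸_F))`, any Haar measure `ν` of `N(𝔸_F)` and fundamental domain `𝓕` of `N(F)`, `cl` constant along `N(F)`
  on `B(F)` (★ GENERIC `kernelBorelClass_eq_smul_tsum_integral` — Rogawski's printed `K_{B,𝔬}` — with the one-point torus
  cell of §1).

## References

* J. D. Rogawski, *Automorphic Representations of Unitary Groups in Three Variables*, Annals of Mathematics Studies 123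
  (1990), §2.2 (p. 13), Prop. 7.2.1 (pp. 91–92), Prop. 7.3.1 (p. 98), §7.3 (p. 95) [Rogawski1990].
* J. Arthur, *A trace formula for reductive groups I*, Duke Math. J. 45 (1978), §8 [Arthur1978TraceFormulaI].
-/

set_option autoImplicit false

noncomputable section

open NumberField IsDedekindDomain Matrix Polynomial MeasureTheory
open scoped MatrixGroups

namespace Literature.NumberTheory.Automorphic

namespace UnitaryGroup

variable {F E : Type} [Field F] [NumberField F] [Field E] [NumberField E] [Algebra F E]
  {c : E ≃ₐ[F] E} {ι : Type*}

/-! ## §1 `U(J₂)`: the torus cell of the class `(X − z)²` is the single point `z·1` -/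

/-- **A rational TORUS element of `U(J₂)` of the class `(X − z)²` is `z·1`** (`z ∈ E¹`): its rational matrix is diagonal
(off-diagonal entries are principal adeles equal to `0`) with `charpoly = (X − z)²`, so both diagonal entries are `z` (★
`apply_self_eq_of_blockTriangular_of_charpoly_eq_sq_two`) — «since `γ` is singular, `𝔬_st ∩ M = {γ}`» at the central class
of `U(2)`; the twin of ★ `coe_eq_toAdelic_ratCenter_of_charpoly_eq`. [cite: Rogawski1990, Prop. 7.2.1 (pp. 91–92)]
[cite: Rogawski1990, Prop. 7.3.1 (p. 98)] -/
theorem coe_eq_toAdelic_ratCenter_of_charpoly_eq_sq_two (ζ : ratOne F E c) {t : rationalTorus F E c 2}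
    (ht : ((adelicVal F E c 2 _ (((t : rationalTorus F E c 2) : torusAdelic F E c 2) :
        (quasiSplit F E c 2).Adelic) : GL (Fin 2) (AdeleRing (𝓞 E) E)) :
        Matrix (Fin 2) (Fin 2) (AdeleRing (𝓞 E) E)).charpoly =
      ((X - C ((ζ : Eˣ) : E)) ^ 2).map (algebraMap E (AdeleRing (𝓞 E) E))) :
    (((t : rationalTorus F E c 2) : torusAdelic F E c 2) : (quasiSplit F E c 2).Adelic) =
      (quasiSplit F E c 2).toAdelic (ratCenter F E c 2 ((StdForm.antidiagonal 2).over E) ζ) := by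
  obtain ⟨t₀, ht₀⟩ := (show (((t : rationalTorus F E c 2) : torusAdelic F E c 2) : (quasiSplit F E c 2).Adelic) ∈
    (quasiSplit F E c 2).arithmeticSubgroup from t.2)
  -- the rational matrix `T₀` of `t₀` is diagonal
  obtain ⟨d, -, hd⟩ := (mem_torusAdelic_iff _).1 ((t : rationalTorus F E c 2) : torusAdelic F E c 2).2
  set T₀ : Matrix (Fin 2) (Fin 2) E := ((t₀.1 : GL (Fin 2) E) : Matrix (Fin 2) (Fin 2) E) with hT₀
  have hmap : T₀.map (algebraMap E (AdeleRing (𝓞 E) E)) =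
      ((glDiagonal 2 (AdeleRing (𝓞 E) E) d : GL (Fin 2) (AdeleRing (𝓞 E) E)) :
        Matrix (Fin 2) (Fin 2) (AdeleRing (𝓞 E) E)) := by
    rw [hd, ← ht₀]; rfl
  have hoff : ∀ i j, i ≠ j → T₀ i j = 0 := by
    intro i j hij
    have h := congrFun (congrFun hmap i) j
    rw [Matrix.map_apply, coe_glDiagonal, Matrix.diagonal_apply_ne _ hij] at h
    exact (map_eq_zero_iff _ (AdeleRing.algebraMap_injective (𝓞 E) E)).1 h
  have hB : T₀.BlockTriangular id := fun i j hij => hoff i j (ne_of_gt hij)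
  -- its characteristic polynomial is `(X − z)²`, hence both diagonal entries are `z`
  have hchar₀ : T₀.charpoly = (X - C ((ζ : Eˣ) : E)) ^ 2 := by
    have h := ht
    rw [← ht₀, charpoly_adelicVal_toAdelic] at h
    exact Polynomial.map_injective _ (AdeleRing.algebraMap_injective (𝓞 E) E) h
  have hdiag : ∀ i, T₀ i i = ((ζ : Eˣ) : E) := apply_self_eq_of_blockTriangular_of_charpoly_eq_sq_two hB hchar₀
  -- so `t₀ = z·1`
  have ht₀eq : t₀ = ratCenter F E c 2 ((StdForm.antidiagonal 2).over E) ζ := by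
    refine Subtype.ext (Units.ext ?_)
    change T₀ = (((ratCenter F E c 2 ((StdForm.antidiagonal 2).over E) ζ : rational F E c 2 _) :
      GL (Fin 2) E) : Matrix (Fin 2) (Fin 2) E)
    rw [coe_ratCenter]
    ext i j
    by_cases hij : i = j
    · subst hij; simp [hdiag]
    · simp [hoff i j hij, hij]
  rw [← ht₀, ht₀eq]

/-! ## §2 `K_{B,𝔬}(x, y) = ν(𝓕)⁻¹ ∫_{N(𝔸_F)} f(x⁻¹ z₁ m y) dν(m)` at the central class of `U(J₂)` -/

section KernelBorelClass

variable [MeasurableSpace (adelicUnipotent F E c 2)] [BorelSpace (adelicUnipotent F E c 2)]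

/-- **`K_{B,𝔬}(x, y) = ν(𝓕)⁻¹ ∫_{N(𝔸_F)} f(x⁻¹ · z₁ · m · y) dν(m)` FOR THE CLASS OF `z · 𝒰(F)` IN `U(J₂)`** (`z ∈ E¹`,
`z₁ = toAdelic (z·1)`): Rogawski's `K_{B,𝔬}(x, y) = Σ_{t ∈ T(F) ∩ 𝔬} ∫_𝐍 f(x⁻¹ t n y) dn` (★ GENERIC
`kernelBorelClass_eq_smul_tsum_integral`, for `f ∈ C_c(G(𝔸_F))`, any Haar measure `ν` of `N(𝔸_F)` and fundamental domain `𝓕`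
of `N(F)`, `cl` constant along `N(F)` on `B(F)`) has ONE term, `t = z·1` (§1), for a class map whose fibre at `i` is
`{charpoly = (X − z)² ⊗ 𝔸_E}` — the integrand `∫_𝐍 f(g⁻¹ γ n g) dn` of the central term of [Rogawski1990, Prop. 7.3.1 p. 98]
before the `K`- and `M`-integrations; the twin of ★ `kernelBorelClass_eq_smul_integral_central`. [cite: Rogawski1990, §2.2 (p. 13)]
[cite: Rogawski1990, Prop. 7.3.1 (p. 98)] -/
theorem kernelBorelClass_eq_smul_integral_central_two {cl : (quasiSplit F E c 2).arithmeticSubgroup → ι}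
    (ν : Measure (adelicUnipotent F E c 2)) [ν.IsHaarMeasure]
    {𝓕 : Set (adelicUnipotent F E c 2)} (h𝓕 : IsFundamentalDomain (rationalUnipotent F E c 2) 𝓕 ν)
    (hclN : IsUnipotentInvariantOnBorel F E c 2 cl) (ζ : ratOne F E c) {i : ι}
    (hcl : ∀ γ : (quasiSplit F E c 2).arithmeticSubgroup, cl γ = i ↔
      ((adelicVal F E c 2 _ (γ : (quasiSplit F E c 2).Adelic) : GL (Fin 2) (AdeleRing (𝓞 E) E)) :
          Matrix (Fin 2) (Fin 2) (AdeleRing (𝓞 E) E)).charpoly =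
        ((X - C ((ζ : Eˣ) : E)) ^ 2).map (algebraMap E (AdeleRing (𝓞 E) E)))
    {f : (quasiSplit F E c 2).Adelic → ℂ} (hfc : Continuous f) (hf : HasCompactSupport f)
    (x y : (quasiSplit F E c 2).Adelic) :
    kernelBorelClass ν 𝓕 cl i f x y = ((ν 𝓕).toReal⁻¹ : ℝ) •
      ∫ m : adelicUnipotent F E c 2,
        f (x⁻¹ * (quasiSplit F E c 2).toAdelic (ratCenter F E c 2 ((StdForm.antidiagonal 2).over E) ζ) *
          ((m : adelicUnipotent F E c 2) : (quasiSplit F E c 2).Adelic) * y) ∂ν := by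
  rw [kernelBorelClass_eq_smul_tsum_integral ν h𝓕 hclN hfc hf x y i]
  congr 1
  -- the index subtype `{t ∈ T(F) : cl t = i}` is the singleton `{z·1}`
  set zR := ratCenter F E c 2 ((StdForm.antidiagonal 2).over E) ζ with hzR
  have hzT : (quasiSplit F E c 2).toAdelic zR ∈ torusAdelic F E c 2 := by
    refine ⟨fun _ => Units.map (algebraMap E (AdeleRing (𝓞 E) E) : E →* AdeleRing (𝓞 E) E) (ζ : Eˣ), ?_⟩
    refine Units.ext ?_
    change _ = (((zR : rational F E c 2 _) : GL (Fin 2) E) : Matrix (Fin 2) (Fin 2) E).map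
      (algebraMap E (AdeleRing (𝓞 E) E))
    rw [coe_glDiagonal, hzR, coe_ratCenter, Matrix.smul_one_eq_diagonal, Matrix.diagonal_map (map_zero _)]
    rfl
  set t₀ : {t : rationalTorus F E c 2 //
      cl ⟨((t : torusAdelic F E c 2) : (quasiSplit F E c 2).Adelic), t.2⟩ = i} :=
    ⟨⟨⟨(quasiSplit F E c 2).toAdelic zR, hzT⟩, ⟨zR, rfl⟩⟩, (hcl _).2 (charpoly_toAdelic_ratCenter_fin ζ)⟩ with ht₀
  rw [tsum_eq_single t₀]
  · intro t ht
    exfalso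
    apply ht
    have hct := (hcl ⟨(((t : rationalTorus F E c 2) : torusAdelic F E c 2) : (quasiSplit F E c 2).Adelic),
      (t : rationalTorus F E c 2).2⟩).1 t.2
    have heq := coe_eq_toAdelic_ratCenter_of_charpoly_eq_sq_two ζ hct
    exact Subtype.ext (Subtype.ext (Subtype.ext heq))

end KernelBorelClass

end UnitaryGroup

end Literature.NumberTheory.Automorphic

end
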